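import Literature.NumberTheory.Sieve.SmoothSaddlePoint
import Literature.NumberTheory.Sieve.PsiPolylogUpperBound
import Mathlib.NumberTheory.Chebyshev
import HarnessLib

/-!
# The saddle point in the polylogarithmic range: `α(x, logᴷ x) = 1 - 1/K + o(1)`

Topic `NumberTheory/Sieve` (smooth numbers); PROOF companion of `SmoothSaddlePoint.lean` (the
Hildebrand–Tenenbaum saddle point `saddlePoint x y = α(x, y)`, the unique positive root of
`saddleSum α y = Σ_{p ≤ y} log p/(p^α - 1) = log x`). Everything here is PROVED; no definition,
no named fact.

Hildebrand–Tenenbaum's approximation [HildebrandTenenbaum1986, Thm 2 (2.4); Lemma 2] gives, for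
`log x < y ≤ x`, `α(x, y) = 1 - log(u log(u+1))/log y + O(1/log y)` (`u = log x/log y`), quoted as
(2.1) in [Harper2016, §2.1] and USED there (§5, proof of Prop. 5) only through its consequence
"`1 - α(x, y) ≤ 1/K + o(1)`" for `y ≥ logᴷ x`. This file proves that consequence, and the matching
bound in the other direction, by Chebyshev-strength prime number theory only:

* `theta_mul_rpow_neg_le_saddleSum` — `θ(y) y^{-σ} ≤ Σ_{p ≤ y} log p/(p^σ - 1)`;
* `saddleSum_le_log_mul` — `Σ_{p ≤ y} log p/(p^σ - 1) ≤ (1 - 2^{-σ})⁻¹ log y (1 + (y+1)^{1-σ}/(1-σ))`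
  for `0 < σ < 1` (the tree's `sum_primesBelow_rpow_neg_le_of_lt_one`);
* `le_saddlePoint_of_polylog` — for `K > 0`, `ε > 0` and all large `x : ℕ`: every `y ≥ (log x)^K`
  has `α(x, y) ≥ 1 - 1/K - ε` (Mathlib's `Chebyshev.theta_ge`: `θ(y) y^{-σ} ≫ y^{1/K+ε} ≥ log x`
  at `σ = 1 - 1/K - ε`, and `α < σ ⟺ saddleSum σ y < log x`, `saddlePoint_lt_iff`);
* `saddlePoint_le_of_polylog` — for `K ≥ 1`, `ε > 0` and all large `x`: every `2 ≤ y ≤ (log x)^K`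
  has `α(x, y) ≤ 1 - 1/K + ε` (at `σ = 1 - 1/K + ε` the sum is `≪ log log x · (log x)^{1-Kε} = o(log x)`).

Together: `α(x, ⌊logᴷ x⌋) = 1 - 1/K + o(1)` (`saddlePoint_polylog_sandwich`), consistent with
`Ψ(x, logᴷ x) = x^{1-1/K+o(1)}` (`card_factoredUpTo_polylog_sandwich`) and Rankin's bound
`Ψ(x, y) ≤ x^α ζ(α, y)` (`card_smoothNumbersUpTo_le_rankin_saddlePoint`).

## References

* [HildebrandTenenbaum1986] A. Hildebrand, G. Tenenbaum, Trans. AMS 296 (1986), Thm 2 (2.4) and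
  Lemma 2 (3.3)–(3.5) (the sharper forms; held: `paper:doi-10-1090-s0002-9947-1986-0837811-1`).
* [Harper2016] A. J. Harper, Compositio Math. 152 (2016), §2.1 (2.1) and §5 (proof of Prop. 5:
  "`1 - α(x,y) ≤ 1/K + o(1) ≤ 1/100`").
-/

noncomputable section

open Real Filter Finset Topology

namespace Literature.NumberTheory.Sieve

variable {σ : ℝ} {y y' : ℕ}

/-! ### Elementary bounds for `-φ₁(σ, y)` -/

/-- `-φ₁(σ, y)` is increasing in `y` (more primes). [folklore] -/
theorem saddleSum_mono_right (hσ : 0 < σ) (h : y ≤ y') : saddleSum σ y ≤ saddleSum σ y' := by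
  refine Finset.sum_le_sum_of_subset_of_nonneg (fun p hp => ?_) fun p hp _ => (saddleSum_term_pos hp hσ).le
  obtain ⟨hpy, hp⟩ := Nat.mem_primesLE.1 hp
  exact Nat.mem_primesLE.2 ⟨hpy.trans h, hp⟩

/-- **Chebyshev from below**: `θ(y) · y^{-σ} ≤ Σ_{p ≤ y} log p/(p^σ - 1)` for `σ > 0` (termwise,
`y^{-σ} ≤ p^{-σ} ≤ 1/(p^σ - 1)`). [folklore] -/
theorem theta_mul_rpow_neg_le_saddleSum (hσ : 0 < σ) (y : ℕ) :
    Chebyshev.theta y * (y : ℝ) ^ (-σ) ≤ saddleSum σ y := by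
  rw [Chebyshev.theta_eq_sum_primesLE_log, Finset.sum_mul, saddleSum]
  refine Finset.sum_le_sum fun p hp => ?_
  obtain ⟨hpy, hpp⟩ := Nat.mem_primesLE.1 hp
  have hp2 : (2 : ℝ) ≤ p := by exact_mod_cast hpp.two_le
  have hp0 : (0 : ℝ) < p := by linarith
  have hpy' : (p : ℝ) ≤ y := by exact_mod_cast hpy
  have hlog : 0 ≤ Real.log p := Real.log_nonneg (by linarith)
  have hpσ : 1 < (p : ℝ) ^ σ := Real.one_lt_rpow (by linarith) hσ
  calc Real.log p * (y : ℝ) ^ (-σ) ≤ Real.log p * (p : ℝ) ^ (-σ) :=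
        mul_le_mul_of_nonneg_left (Real.rpow_le_rpow_of_nonpos hp0 hpy' (by linarith)) hlog
    _ = Real.log p / (p : ℝ) ^ σ := by rw [Real.rpow_neg hp0.le, div_eq_mul_inv]
    _ ≤ Real.log p / ((p : ℝ) ^ σ - 1) :=
        div_le_div_of_nonneg_left hlog (by linarith) (by linarith)

/-- **Upper bound**: `Σ_{p ≤ y} log p/(p^σ - 1) ≤ (1 - 2^{-σ})⁻¹ · log y · (1 + (y+1)^{1-σ}/(1-σ))` for
`0 < σ < 1` and `y ≥ 1` (`log p ≤ log y`, `1/(p^σ - 1) ≤ p^{-σ}/(1 - 2^{-σ})`, and the tree's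
`sum_primesBelow_rpow_neg_le_of_lt_one`). [folklore] -/
theorem saddleSum_le_log_mul (hσ0 : 0 < σ) (hσ1 : σ < 1) (hy : 1 ≤ y) :
    saddleSum σ y ≤
      (1 - (2 : ℝ) ^ (-σ))⁻¹ * Real.log y * (1 + ((y : ℝ) + 1) ^ (1 - σ) / (1 - σ)) := by
  set A : ℝ := (1 - (2 : ℝ) ^ (-σ))⁻¹ with hA
  have hv₀1 : (2 : ℝ) ^ (-σ) < 1 := Real.rpow_lt_one_of_one_lt_of_neg one_lt_two (by linarith)
  have hA0 : 0 < A := inv_pos.2 (by linarith)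
  have hy0 : (0 : ℝ) < y := by exact_mod_cast hy
  have hlogy : 0 ≤ Real.log y := Real.log_nonneg (by exact_mod_cast hy)
  -- termwise bound
  have hterm : ∀ p ∈ Nat.primesLE y,
      Real.log p / ((p : ℝ) ^ σ - 1) ≤ A * Real.log y * (p : ℝ) ^ (-σ) := by
    intro p hp
    obtain ⟨hpy, hpp⟩ := Nat.mem_primesLE.1 hp
    have hp2 : (2 : ℝ) ≤ p := by exact_mod_cast hpp.two_le
    have hp0 : (0 : ℝ) < p := by linarith
    have hpσ : 0 < (p : ℝ) ^ σ := Real.rpow_pos_of_pos hp0 σ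
    have hv : (p : ℝ) ^ (-σ) ≤ (2 : ℝ) ^ (-σ) := Real.rpow_le_rpow_of_nonpos two_pos hp2 (by linarith)
    have hvp0 : 0 < (p : ℝ) ^ (-σ) := Real.rpow_pos_of_pos hp0 _
    have hlogp : Real.log p ≤ Real.log y := Real.log_le_log hp0 (by exact_mod_cast hpy)
    have hlogp0 : 0 ≤ Real.log p := Real.log_nonneg (by linarith)
    have hden : 0 < (p : ℝ) ^ σ - 1 := by
      have := Real.one_lt_rpow (by linarith : (1 : ℝ) < p) hσ0; linarith
    -- `1/(p^σ - 1) = p^{-σ}/(1 - p^{-σ}) ≤ A p^{-σ}`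
    have hinv : 1 / ((p : ℝ) ^ σ - 1) ≤ A * (p : ℝ) ^ (-σ) := by
      have h1 : 1 / ((p : ℝ) ^ σ - 1) = (p : ℝ) ^ (-σ) / (1 - (p : ℝ) ^ (-σ)) := by
        rw [Real.rpow_neg hp0.le]
        have hne : (p : ℝ) ^ σ - 1 ≠ 0 := by
          have := Real.one_lt_rpow (by linarith : (1 : ℝ) < p) hσ0; linarith
        field_simp
      rw [h1, hA, div_eq_mul_inv, mul_comm]
      refine mul_le_mul_of_nonneg_right ?_ hvp0.le
      exact inv_anti₀ (by linarith) (by linarith)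
    calc Real.log p / ((p : ℝ) ^ σ - 1) = Real.log p * (1 / ((p : ℝ) ^ σ - 1)) := by
          rw [mul_one_div]
      _ ≤ Real.log y * (A * (p : ℝ) ^ (-σ)) :=
          mul_le_mul hlogp hinv (one_div_pos.2 hden).le hlogy
      _ = A * Real.log y * (p : ℝ) ^ (-σ) := by ring
  -- sum, and the tree's prime-sum bound (`primesLE y = primesBelow (y + 1)`)
  have hsum : ∑ p ∈ Nat.primesLE y, (p : ℝ) ^ (-σ) ≤ 1 + ((y : ℝ) + 1) ^ (1 - σ) / (1 - σ) := by
    have h := sum_primesBelow_rpow_neg_le_of_lt_one hσ0 hσ1 (y + 1)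
    push_cast at h
    exact h
  calc saddleSum σ y ≤ ∑ p ∈ Nat.primesLE y, A * Real.log y * (p : ℝ) ^ (-σ) := Finset.sum_le_sum hterm
    _ = A * Real.log y * ∑ p ∈ Nat.primesLE y, (p : ℝ) ^ (-σ) := by rw [Finset.mul_sum]
    _ ≤ A * Real.log y * (1 + ((y : ℝ) + 1) ^ (1 - σ) / (1 - σ)) :=
        mul_le_mul_of_nonneg_left hsum (by positivity)

/-! ### The polylogarithmic range -/

/-- **`α(x, y) ≥ 1 - 1/K - ε` for `y ≥ logᴷ x / 2`** (`K > 0`, `ε > 0`, all large `x : ℕ`; the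
factor `1/2` lets `y = ⌊logᴷ x⌋` in): the consequence "`1 - α(x, y) ≤ 1/K + o(1)`" of
[HildebrandTenenbaum1986, Thm 2 (2.4)] used in [Harper2016, §5, proof of Prop. 5], here from
Chebyshev's bound alone: at `σ = 1 - 1/K - ε`,
`Σ_{p ≤ y} log p/(p^σ - 1) ≥ θ(y) y^{-σ} ≥ y^{1-σ}/4 ≥ (logᴷ x/2)^{1/K + ε}/4 > log x`, so `α ≥ σ`.
[cite: Harper2016, §2.1 (2.1) and §5 (proof of Prop. 5)] -/
theorem le_saddlePoint_of_polylog {K ε : ℝ} (hK : 0 < K) (hε : 0 < ε) :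
    ∀ᶠ x : ℕ in atTop, ∀ y : ℕ, Real.log x ^ K / 2 ≤ y → 1 - 1 / K - ε ≤ saddlePoint x y := by
  set σ : ℝ := 1 - 1 / K - ε with hσ
  -- tendsto facts
  have hcast : Tendsto (fun x : ℕ => (x : ℝ)) atTop atTop := tendsto_natCast_atTop_atTop
  have Tℓ : Tendsto (fun x : ℕ => Real.log x) atTop atTop := Real.tendsto_log_atTop.comp hcast
  have E0 : ∀ᶠ x : ℕ in atTop, (3 : ℝ) ≤ x := hcast.eventually_ge_atTop 3
  have E1 : ∀ᶠ x : ℕ in atTop, (2 : ℝ) ≤ Real.log x := Tℓ.eventually_ge_atTop 2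
  have E1' : ∀ᶠ x : ℕ in atTop, (6 : ℝ) ≤ Real.log x ^ K :=
    ((tendsto_rpow_atTop hK).comp Tℓ).eventually_ge_atTop 6
  by_cases hσ0 : σ ≤ 0
  · -- trivial: `α > 0 ≥ σ`
    filter_upwards [E0, E1'] with x h0 h1' y hy
    have hx1 : (1 : ℝ) < x := by linarith
    have hy2 : 2 ≤ y := by
      have h6 : (6 : ℝ) ≤ Real.log x ^ K := h1'
      have : (2 : ℝ) < y := by linarith
      have : 2 < y := by exact_mod_cast this
      omega
    exact hσ0.trans (saddlePoint_pos hx1 hy2).le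
  push Not at hσ0
  have hKinv : 0 < 1 / K := by positivity
  -- `θ(n) ≥ n/4` for large `n`, transported to `y ≥ ⌊(log x)^K⌋`
  have hθ : ∀ᶠ n : ℕ in atTop, (n : ℝ) / 4 ≤ Chebyshev.theta n := by
    have h1 : ∀ᶠ n : ℕ in atTop, Real.log ((n : ℝ) + 1) ≤ (n : ℝ) / 8 := by
      have h := (Real.isLittleO_log_id_atTop.comp_tendsto
        (tendsto_atTop_add_const_right _ (1 : ℝ) hcast)).bound (by norm_num : (0 : ℝ) < 1 / 16)
      filter_upwards [h, hcast.eventually_ge_atTop 1] with n hn hn1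
      simp only [Function.comp_apply, id_eq, Real.norm_eq_abs] at hn
      rw [abs_of_nonneg (Real.log_nonneg (by linarith)), abs_of_nonneg (by linarith)] at hn
      linarith
    have h2 : ∀ᶠ n : ℕ in atTop, 2 * Real.sqrt n * Real.log n ≤ (n : ℝ) / 8 := by
      -- `√n log n = o(n)`: `log n ≤ n^{1/4}` eventually... use `log n = o(n^{1/2})`
      have h := ((isLittleO_log_rpow_atTop (by norm_num : (0 : ℝ) < 1 / 2)).comp_tendsto hcast).bound
        (by norm_num : (0 : ℝ) < 1 / 16)
      filter_upwards [h, hcast.eventually_ge_atTop 1] with n hn hn1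
      simp only [Function.comp_apply, Real.norm_eq_abs] at hn
      have hn0 : (0 : ℝ) ≤ n := by linarith
      rw [abs_of_nonneg (Real.log_nonneg hn1), abs_of_nonneg (by positivity)] at hn
      have hsq : Real.sqrt n * (n : ℝ) ^ (1 / 2 : ℝ) = n := by
        rw [Real.sqrt_eq_rpow, ← Real.rpow_add' hn0 (by norm_num)]; norm_num
      calc 2 * Real.sqrt n * Real.log n ≤ 2 * Real.sqrt n * (1 / 16 * (n : ℝ) ^ (1 / 2 : ℝ)) :=
            mul_le_mul_of_nonneg_left hn (by positivity)
        _ = (Real.sqrt n * (n : ℝ) ^ (1 / 2 : ℝ)) / 8 := by ring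
        _ = (n : ℝ) / 8 := by rw [hsq]
    filter_upwards [h1, h2] with n hn1 hn2
    have := Chebyshev.theta_ge n
    have hlog2 := Real.log_two_gt_d9
    nlinarith [Nat.cast_nonneg (α := ℝ) n]
  -- transport to `x` through `⌊(log x)^K⌋ → ∞`
  have Tfl : Tendsto (fun x : ℕ => ⌊Real.log x ^ K / 2⌋₊) atTop atTop :=
    tendsto_nat_floor_atTop.comp (((tendsto_rpow_atTop hK).comp Tℓ).atTop_div_const two_pos)
  have E2 : ∀ᶠ x : ℕ in atTop, ∀ n : ℕ, ⌊Real.log x ^ K / 2⌋₊ ≤ n →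
      (n : ℝ) / 4 ≤ Chebyshev.theta n := by
    obtain ⟨N, hN⟩ := hθ.exists_forall_of_atTop
    filter_upwards [Tfl.eventually_ge_atTop N] with x hx n hn
    exact hN n (hx.trans hn)
  -- the size condition `((log x)^K/2)^{1-σ}/4 ≥ log x`, i.e. `(log x)^{Kε'}` large
  have E3 : ∀ᶠ x : ℕ in atTop, Real.log x ≤ (Real.log x ^ K / 2) ^ (1 - σ) / 4 := by
    -- `(ℓ^K/2)^{1-σ} = 2^{-(1-σ)} ℓ^{K(1-σ)}` and `K(1-σ) = 1 + Kε > 1`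
    have hexp : 1 < K * (1 - σ) := by
      rw [hσ]; field_simp; nlinarith
    have h := ((tendsto_rpow_atTop (by linarith : 0 < K * (1 - σ) - 1)).comp Tℓ).eventually_ge_atTop
      (4 * (2 : ℝ) ^ (1 - σ))
    filter_upwards [h, E1] with x hx h1
    have hℓ0 : 0 < Real.log x := by linarith
    simp only [Function.comp_apply] at hx
    have hsplit : (Real.log x ^ K / 2) ^ (1 - σ) =
        (2 : ℝ) ^ (-(1 - σ)) * (Real.log x * Real.log x ^ (K * (1 - σ) - 1)) := by
      rw [Real.div_rpow (by positivity) zero_le_two, ← Real.rpow_mul hℓ0.le, Real.rpow_neg zero_le_two,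
        div_eq_mul_inv, mul_comm]
      congr 1
      rw [← Real.rpow_one_add' hℓ0.le (by linarith)]
      ring_nf
    rw [hsplit]
    have h2 : (0 : ℝ) < (2 : ℝ) ^ (-(1 - σ)) := Real.rpow_pos_of_pos two_pos _
    have h22 : (2 : ℝ) ^ (-(1 - σ)) * (2 : ℝ) ^ (1 - σ) = 1 := by
      rw [← Real.rpow_add two_pos]; simp
    -- `ℓ ≤ 2^{-(1-σ)} ℓ ℓ^{K(1-σ)-1} / 4` iff `4 · 2^{1-σ} ≤ ℓ^{K(1-σ)-1}`
    rw [le_div_iff₀ (by norm_num : (0 : ℝ) < 4)]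
    calc Real.log x * 4 = (2 : ℝ) ^ (-(1 - σ)) * (Real.log x * (4 * (2 : ℝ) ^ (1 - σ))) := by
          rw [show (2 : ℝ) ^ (-(1 - σ)) * (Real.log x * (4 * (2 : ℝ) ^ (1 - σ))) =
            Real.log x * 4 * ((2 : ℝ) ^ (-(1 - σ)) * (2 : ℝ) ^ (1 - σ)) by ring, h22, mul_one]
      _ ≤ (2 : ℝ) ^ (-(1 - σ)) * (Real.log x * Real.log x ^ (K * (1 - σ) - 1)) :=
          mul_le_mul_of_nonneg_left (mul_le_mul_of_nonneg_left hx hℓ0.le) h2.le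
  filter_upwards [E0, E1, E1', E2, E3] with x h0 h1 h1' h2 h3 y hy
  have hx1 : (1 : ℝ) < x := by linarith
  have hℓ0 : 0 < Real.log x := by linarith
  have hy2r : (2 : ℝ) < y := by
    have h6 : (6 : ℝ) ≤ Real.log x ^ K := h1'
    linarith
  have hy2 : 2 ≤ y := by
    have : 2 < y := by exact_mod_cast hy2r
    omega
  have hy0 : (0 : ℝ) < y := by linarith
  -- `α ≥ σ` iff `saddleSum σ y ≥ log x`
  by_contra hlt
  push Not at hlt
  have hsmall : saddleSum σ y < Real.log x := (saddlePoint_lt_iff hx1 hy2 hσ0).1 hlt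
  -- `saddleSum σ y ≥ θ(y) y^{-σ} ≥ (y/4) y^{-σ} = y^{1-σ}/4 ≥ ((log x)^K/2)^{1-σ}/4 ≥ log x`
  have hfl : ⌊Real.log x ^ K / 2⌋₊ ≤ y := Nat.floor_le_of_le hy
  have hθy := h2 y hfl
  have hlow : (y : ℝ) ^ (1 - σ) / 4 ≤ saddleSum σ y := by
    calc (y : ℝ) ^ (1 - σ) / 4 = (y : ℝ) / 4 * (y : ℝ) ^ (-σ) := by
          rw [Real.rpow_sub hy0, Real.rpow_one, Real.rpow_neg hy0.le]; ring
      _ ≤ Chebyshev.theta y * (y : ℝ) ^ (-σ) :=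
          mul_le_mul_of_nonneg_right hθy (Real.rpow_nonneg hy0.le _)
      _ ≤ saddleSum σ y := theta_mul_rpow_neg_le_saddleSum hσ0 y
  have hyhalf : Real.log x ^ K / 2 ≤ y := hy
  have hpow : (Real.log x ^ K / 2) ^ (1 - σ) ≤ (y : ℝ) ^ (1 - σ) :=
    Real.rpow_le_rpow (by positivity) hyhalf (by linarith)
  linarith [div_le_div_of_nonneg_right hpow (by norm_num : (0 : ℝ) ≤ 4)]

/-- **`α(x, y) ≤ 1 - 1/K + ε` for `2 ≤ y ≤ logᴷ x`** (`K ≥ 1`, `ε > 0`, all large `x : ℕ`): at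
`σ = 1 - 1/K + ε` (with `ε < 1/K` w.l.o.g.) one has
`Σ_{p ≤ y} log p/(p^σ - 1) ≪ log log x · (log x)^{K(1-σ)} = log log x · (log x)^{1 - Kε} = o(log x)`,
so `saddleSum σ y < log x` and `α < σ`. The matching half of `α(x, logᴷ x) = 1 - 1/K + o(1)`
[HildebrandTenenbaum1986, Thm 2 (2.4)]. [cite: HildebrandTenenbaum1986, Thm 2 (2.4)] -/
theorem saddlePoint_le_of_polylog {K ε : ℝ} (hK : 1 ≤ K) (hε : 0 < ε) :
    ∀ᶠ x : ℕ in atTop, ∀ y : ℕ, 2 ≤ y → (y : ℝ) ≤ Real.log x ^ K →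
      saddlePoint x y ≤ 1 - 1 / K + ε := by
  have hK0 : 0 < K := by linarith
  have hKinv : 0 < 1 / K := by positivity
  have hKinv1 : 1 / K ≤ 1 := by rw [div_le_one hK0]; exact hK
  -- shrink `ε` below `1/K`
  set ε' : ℝ := min ε (1 / (2 * K)) with hε'
  have hε'0 : 0 < ε' := lt_min hε (by positivity)
  have hε'ε : ε' ≤ ε := min_le_left _ _
  have hε'K : ε' ≤ 1 / (2 * K) := min_le_right _ _
  have h2K : 1 / (2 * K) < 1 / K := by
    rw [one_div_lt_one_div (by positivity) hK0]; linarith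
  set σ : ℝ := 1 - 1 / K + ε' with hσ
  have hσ0 : 0 < σ := by rw [hσ]; linarith
  have hσ1 : σ < 1 := by rw [hσ]; linarith
  set A : ℝ := (1 - (2 : ℝ) ^ (-σ))⁻¹ with hA
  have hv₀1 : (2 : ℝ) ^ (-σ) < 1 := Real.rpow_lt_one_of_one_lt_of_neg one_lt_two (by linarith)
  have hA0 : 0 < A := inv_pos.2 (by linarith)
  set B : ℝ := 1 / (1 - σ) with hB
  have hB0 : 0 < B := by rw [hB]; exact div_pos one_pos (by linarith)
  -- `θ = K (1 - σ) = 1 - K ε' ∈ [1/2, 1)`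
  set θ : ℝ := K * (1 - σ) with hθ
  have hθ1 : 0 < 1 - θ := by
    have : θ = 1 - K * ε' := by rw [hθ, hσ]; field_simp; ring
    rw [this]; nlinarith
  -- tendsto facts
  have hcast : Tendsto (fun x : ℕ => (x : ℝ)) atTop atTop := tendsto_natCast_atTop_atTop
  have Tℓ : Tendsto (fun x : ℕ => Real.log x) atTop atTop := Real.tendsto_log_atTop.comp hcast
  have Tℓ₂ : Tendsto (fun x : ℕ => Real.log (Real.log x)) atTop atTop := Real.tendsto_log_atTop.comp Tℓ
  have E0 : ∀ᶠ x : ℕ in atTop, (3 : ℝ) ≤ x := hcast.eventually_ge_atTop 3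
  have E1 : ∀ᶠ x : ℕ in atTop, (2 : ℝ) ≤ Real.log x := Tℓ.eventually_ge_atTop 2
  have E2 : ∀ᶠ x : ℕ in atTop, (1 : ℝ) ≤ Real.log (Real.log x) := Tℓ₂.eventually_ge_atTop 1
  -- the decisive smallness: `8 A B K · log log x · ℓ^θ ≤ ℓ / 2`... via `log log x ≤ ℓ^{(1-θ)/2}` and
  -- `ℓ^{-(1-θ)/2}` small
  have E3 : ∀ᶠ x : ℕ in atTop, Real.log (Real.log x) ≤ Real.log x ^ ((1 - θ) / 2) := by
    have h := ((isLittleO_log_rpow_atTop (by positivity : 0 < (1 - θ) / 2)).comp_tendsto Tℓ).bound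
      one_pos
    filter_upwards [h, E1] with x hx h1
    simp only [Function.comp_apply, Real.norm_eq_abs, one_mul] at hx
    rwa [abs_of_nonneg (Real.log_nonneg (by linarith)), abs_of_nonneg (by positivity)] at hx
  have E4 : ∀ᶠ x : ℕ in atTop, Real.log x ^ (-((1 - θ) / 2)) ≤ 1 / (16 * A * B * K) := by
    have h := (tendsto_rpow_neg_atTop (by positivity : 0 < (1 - θ) / 2)).comp Tℓ
    exact h.eventually (ge_mem_nhds (by positivity))
  have E5 : ∀ᶠ x : ℕ in atTop, 4 * A * K * Real.log (Real.log x) ≤ Real.log x / 4 := by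
    -- `log log x = o(log x)`
    have h := (Real.isLittleO_log_id_atTop.comp_tendsto Tℓ).bound
      (by positivity : (0 : ℝ) < 1 / (16 * A * K))
    filter_upwards [h, E1, E2] with x hx h1 h2
    simp only [Function.comp_apply, id_eq, Real.norm_eq_abs] at hx
    rw [abs_of_nonneg (by linarith), abs_of_nonneg (by linarith)] at hx
    have : 4 * A * K * Real.log (Real.log x) ≤ 4 * A * K * (1 / (16 * A * K) * Real.log x) :=
      mul_le_mul_of_nonneg_left hx (by positivity)
    calc 4 * A * K * Real.log (Real.log x) ≤ 4 * A * K * (1 / (16 * A * K) * Real.log x) := this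
      _ = Real.log x / 4 := by field_simp; ring
  filter_upwards [E0, E1, E2, E3, E4, E5] with x h0 h1 h2 h3 h4 h5 y hy2 hyK
  have hx1 : (1 : ℝ) < x := by linarith
  set ℓ : ℝ := Real.log x with hℓ
  have hℓ0 : 0 < ℓ := by linarith
  have hℓ1 : 1 ≤ ℓ := by linarith
  -- it suffices that `saddleSum σ y < log x`
  suffices hmain : saddleSum σ y < ℓ by
    have := ((saddlePoint_lt_iff hx1 hy2 hσ0).2 hmain).le
    rw [hσ] at this; linarith
  have hy1 : 1 ≤ y := by omega
  have hy0 : (0 : ℝ) < y := by exact_mod_cast (by omega : 0 < y)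
  -- `saddleSum σ y ≤ A log y (1 + B (y+1)^{1-σ})`, `log y ≤ K log log x`, `(y+1)^{1-σ} ≤ 2 ℓ^θ`
  have hS := saddleSum_le_log_mul hσ0 hσ1 hy1
  have hlogy : Real.log y ≤ K * Real.log ℓ := by
    calc Real.log y ≤ Real.log (ℓ ^ K) := Real.log_le_log hy0 hyK
      _ = K * Real.log ℓ := Real.log_rpow hℓ0 K
  have hyK1 : (y : ℝ) + 1 ≤ 2 * ℓ ^ K := by
    have : (1 : ℝ) ≤ ℓ ^ K := Real.one_le_rpow hℓ1 hK0.le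
    linarith
  have hpow : ((y : ℝ) + 1) ^ (1 - σ) ≤ 2 * ℓ ^ θ := by
    calc ((y : ℝ) + 1) ^ (1 - σ) ≤ (2 * ℓ ^ K) ^ (1 - σ) :=
          Real.rpow_le_rpow (by positivity) hyK1 (by linarith)
      _ = (2 : ℝ) ^ (1 - σ) * ℓ ^ θ := by
          rw [Real.mul_rpow zero_le_two (by positivity), ← Real.rpow_mul hℓ0.le, hθ]
      _ ≤ 2 * ℓ ^ θ := by
          refine mul_le_mul_of_nonneg_right ?_ (by positivity)
          calc (2 : ℝ) ^ (1 - σ) ≤ (2 : ℝ) ^ (1 : ℝ) :=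
                Real.rpow_le_rpow_of_exponent_le one_le_two (by linarith)
            _ = 2 := Real.rpow_one 2
  have hℓθ : ℓ ^ θ = ℓ * (ℓ ^ (-((1 - θ) / 2)) * ℓ ^ (-((1 - θ) / 2))) := by
    conv_lhs => rw [show θ = 1 + -((1 - θ) / 2) + -((1 - θ) / 2) by ring]
    rw [Real.rpow_add hℓ0, Real.rpow_add hℓ0, Real.rpow_one, mul_assoc]
  -- assemble: `saddleSum ≤ A (K log ℓ) (1 + 2 B ℓ^θ) ≤ ℓ/4 + ℓ/4 < ℓ`
  have hlogℓ0 : 0 ≤ Real.log ℓ := by linarith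
  have hstep1 : saddleSum σ y ≤ A * (K * Real.log ℓ) * (1 + B * (2 * ℓ ^ θ)) := by
    calc saddleSum σ y ≤ A * Real.log y * (1 + ((y : ℝ) + 1) ^ (1 - σ) / (1 - σ)) := hS
      _ = A * Real.log y * (1 + B * ((y : ℝ) + 1) ^ (1 - σ)) := by rw [hB]; ring
      _ ≤ A * (K * Real.log ℓ) * (1 + B * (2 * ℓ ^ θ)) := by
          apply mul_le_mul (mul_le_mul_of_nonneg_left hlogy hA0.le) _ (by positivity) (by positivity)
          exact add_le_add le_rfl (mul_le_mul_of_nonneg_left hpow hB0.le)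
  have hpart1 : A * (K * Real.log ℓ) ≤ ℓ / 4 := by
    have : A * (K * Real.log ℓ) = (4 * A * K * Real.log ℓ) / 4 := by ring
    rw [this]; linarith
  have hpart2 : A * (K * Real.log ℓ) * (B * (2 * ℓ ^ θ)) ≤ ℓ / 4 := by
    -- `log ℓ ≤ ℓ^{(1-θ)/2}` and `ℓ^θ = ℓ · ℓ^{-(1-θ)/2} · ℓ^{-(1-θ)/2}`
    have hll : Real.log ℓ * ℓ ^ (-((1 - θ) / 2)) ≤ 1 := by
      calc Real.log ℓ * ℓ ^ (-((1 - θ) / 2)) ≤ ℓ ^ ((1 - θ) / 2) * ℓ ^ (-((1 - θ) / 2)) :=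
            mul_le_mul_of_nonneg_right h3 (by positivity)
        _ = 1 := by rw [← Real.rpow_add hℓ0]; simp
    calc A * (K * Real.log ℓ) * (B * (2 * ℓ ^ θ))
        = 2 * A * B * K * ℓ * (Real.log ℓ * ℓ ^ (-((1 - θ) / 2))) * ℓ ^ (-((1 - θ) / 2)) := by
          rw [hℓθ]; ring
      _ ≤ 2 * A * B * K * ℓ * 1 * (1 / (16 * A * B * K)) := by
          apply mul_le_mul (mul_le_mul_of_nonneg_left hll (by positivity)) h4 (by positivity)
            (by positivity)
      _ = ℓ / 8 := by field_simp; ring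
      _ ≤ ℓ / 4 := by linarith
  calc saddleSum σ y ≤ A * (K * Real.log ℓ) * (1 + B * (2 * ℓ ^ θ)) := hstep1
    _ = A * (K * Real.log ℓ) + A * (K * Real.log ℓ) * (B * (2 * ℓ ^ θ)) := by ring
    _ ≤ ℓ / 4 + ℓ / 4 := add_le_add hpart1 hpart2
    _ < ℓ := by linarith

/-- **`α(x, ⌊logᴷ x⌋) = 1 - 1/K + o(1)`** (`K ≥ 1`): for `ε > 0` and all large `x : ℕ`,
`1 - 1/K - ε ≤ α(x, ⌊(log x)^K⌋) ≤ 1 - 1/K + ε`. [cite: HildebrandTenenbaum1986, Thm 2 (2.4)] -/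
theorem saddlePoint_polylog_sandwich {K ε : ℝ} (hK : 1 ≤ K) (hε : 0 < ε) :
    ∀ᶠ x : ℕ in atTop,
      1 - 1 / K - ε ≤ saddlePoint x ⌊Real.log x ^ K⌋₊ ∧
        saddlePoint x ⌊Real.log x ^ K⌋₊ ≤ 1 - 1 / K + ε := by
  have hK0 : 0 < K := by linarith
  have Tℓ : Tendsto (fun x : ℕ => Real.log x) atTop atTop :=
    Real.tendsto_log_atTop.comp tendsto_natCast_atTop_atTop
  have E1 : ∀ᶠ x : ℕ in atTop, (3 : ℝ) ≤ Real.log x ^ K :=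
    ((tendsto_rpow_atTop hK0).comp Tℓ).eventually_ge_atTop 3
  filter_upwards [le_saddlePoint_of_polylog (ε := ε) hK0 hε,
    saddlePoint_le_of_polylog hK hε, E1] with x hlo' hhi h3
  have hy0 : 0 ≤ Real.log x ^ K := by linarith
  have hfl : (⌊Real.log x ^ K⌋₊ : ℝ) ≤ Real.log x ^ K := Nat.floor_le hy0
  have hfl2 : 2 ≤ ⌊Real.log x ^ K⌋₊ := Nat.le_floor (by push_cast; linarith)
  refine ⟨hlo' _ ?_, hhi _ hfl2 hfl⟩
  -- `(log x)^K / 2 ≤ ⌊(log x)^K⌋` since `⌊t⌋ > t - 1 ≥ t/2` for `t ≥ 2`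
  have := Nat.lt_floor_add_one (Real.log x ^ K)
  linarith

end Literature.NumberTheory.Sieve

end
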